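import Mathlib.Algebra.BigOperators.Group.Finset.Basic
import Mathlib.Algebra.BigOperators.Ring.Finset
import Mathlib.Data.Fintype.BigOperators
import Mathlib.Data.Finset.Prod
import Mathlib.Tactic
import HarnessLib

/-!
# Venture HSemireg — the BLOW-UP LEMMA for flat four-coordinate designs, the cube design, and the sharpness of THEOREM L at `t = 2d`

Cell `pub-hsemireg`, widening group W5, seat w5-n7-1 (gen 12); files of record
`widen/W5/N7-FEASIBILITY-w5n7.md` (N7F) §3.9 (b) «BLOW-UP LEMMA (exact): replacing every level by g copies and every
torus by the g² tori between copies maps a flat triangle-free design of cell (m, s) to one of cell (g²m, gs) and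
multiplies both ΣN(C₄) and the target by g⁴» and `widen/W5/FLATTF-w5n62g17.md` §0 / §3 (THEOREM L: every flat
triangle-free four-coordinate design has `12 t d³ ≤ 2 ΣN(C₄) + 3 t² d²`; «t = 2d forces the d-fold blow-up of the cube
Q₃ (ΣN = 6d⁴)»; kernel leg `Summits/Ventures/HSemireg/FlatTriangleFreeFourCycles.lean`, theorem `twelve_mul_le`).

SETTING (as in the tree file `FlatTriangleFreeFourCycles`). Four level types `α, β, γ, δ`; six bipartite «torus»
graphs given by neighbourhood maps `nXY : X → Finset Y` (with transposes `nYX`, `y ∈ nXY x ↔ x ∈ nYX y`); FLAT (d, t):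
every level has exactly `d` neighbours in each graph, `t` levels per coordinate; TRIANGLE-FREE: no three pairwise
adjacent levels in three distinct coordinates; the transversal-4-cycle count of the cyclic order `(A B C D)` is spelled
`∑ a, ∑ b ∈ nAB a, ∑ e ∈ nAD a, #(nBC b ∩ nDC e)` and ΣN(C₄) is the sum of the three cyclic orders.

THE g-FOLD BLOW-UP replaces a level type `X` by `X × G` (`G` any finite type with `g` elements) and the map `nXY` by
`p ↦ nXY p.1 ×ˢ univ` (a copy of a level is adjacent to every copy of every old neighbour). What is kernel-checked:

* `mem_blowUp_iff` — transposes stay transposes;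
* `card_blowUp` — every degree is multiplied by `g` (so (d, t) ↦ (g d, g t));
* `triangleFree_blowUp` / `triangle_of_blowUp` — triangle-freeness is preserved and reflected;
* `fourCycleSum_blowUp` — each of the three transversal-4-cycle sums is multiplied by `g ^ 4`
  (so ΣN(C₄) ↦ g⁴ ΣN(C₄)); `ksecantValue_blowUp` — the K-secant value `t d² (7d − 2t)` of N7F §3.9 (b) is multiplied by
  `g ^ 4` as well, and `thmL_bound_blowUp` — so are both sides of THEOREM L's inequality: the BLOW-UP LEMMA;
* `cube_*` — the (d, t) = (1, 2) design «Q₃ with its four antipodal pairs as coordinates» written on `Fin 2`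
  (`nAB = nAC = nAD = singleton`, `nBC = nBD = nCD = (· + 1)`): 1-regular, triangle-free, ΣN(C₄) = 2 + 2 + 2 = 6;
* `cubeBlowUp_*` — its g-fold blow-up on `Fin 2 × G`: g-regular on 2g levels, triangle-free, ΣN(C₄) = 6 g⁴, and
  `cubeBlowUp_thmL_eq` — EQUALITY in THEOREM L: `12 t d³ = 2 ΣN(C₄) + 3 t² d²` with `d = g`, `t = 2g`. Hence the bound
  `twelve_mul_le` of the tree is attained at every `t = 2d` (FLATTF §0 «L is attained»; N7F §3.9 (d) row «flat-4,
  u = 10 … the blow-up of the (2,5) design attains it» is the same mechanism at another (d, t)).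

HONEST FRAMING: finite combinatorics of product finsets and three `decide`s on `Fin 2`; nothing here is a statement
about a variety, a sheaf or a Hodge class; the identification of these designs with «flat K-secant coordinate
skeleta» lives in N7F §3.6–§3.9, not here. Nothing in this file says that HC, HC_CM or HC_AV holds, and no door ∕
tier ∕ report sentence of the cell is a consequence of this file alone. This file does not import the tree leg of
THEOREM L (it only reproduces the two sides of its inequality as expressions).
-/

namespace Summit.Ventures.HSemireg.FlatDesignBlowUp

open Finset

section BlowUp

variable {X Y Z : Type*} {G : Type*} [Fintype G]

/-- **Blow-up keeps transposes.** If `nYX` is the transpose of `nXY`, then `q ↦ nYX q.1 ×ˢ univ` is the transpose of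
`p ↦ nXY p.1 ×ˢ univ` on the blown-up levels `X × G`, `Y × G`. -/
theorem mem_blowUp_iff (nXY : X → Finset Y) (nYX : Y → Finset X)
    (h : ∀ x y, y ∈ nXY x ↔ x ∈ nYX y) (p : X × G) (q : Y × G) :
    q ∈ nXY p.1 ×ˢ (univ : Finset G) ↔ p ∈ nYX q.1 ×ˢ (univ : Finset G) := by
  simp only [mem_product, mem_univ, and_true]
  exact h p.1 q.1

/-- **Blow-up multiplies degrees by `g`.** If every `X`-level has `d` neighbours in `Y`, every blown-up level has
`d * g` neighbours (`g = #G`): the g-fold blow-up of a flat (d, t) design is flat (g d, g t). -/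
theorem card_blowUp (nXY : X → Finset Y) (d : ℕ) (h : ∀ x, (nXY x).card = d) (p : X × G) :
    (nXY p.1 ×ˢ (univ : Finset G)).card = d * Fintype.card G := by
  rw [card_product, h, card_univ]

/-- The number of blown-up levels is `g` times the number of levels. -/
theorem card_levels_blowUp [Fintype X] (t : ℕ) (hX : Fintype.card X = t) :
    Fintype.card (X × G) = t * Fintype.card G := by
  rw [Fintype.card_prod, hX]

/-- **Blow-up preserves triangle-freeness.** A triangle in the blow-up projects to a triangle in the base, so if the
base has no triangle across the coordinates `X, Y, Z`, neither has the blow-up. -/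
theorem triangleFree_blowUp (nXY : X → Finset Y) (nYZ : Y → Finset Z) (nXZ : X → Finset Z)
    (t : ∀ x y z, y ∈ nXY x → z ∈ nYZ y → z ∉ nXZ x) :
    ∀ (p : X × G) (q : Y × G) (r : Z × G), q ∈ nXY p.1 ×ˢ (univ : Finset G) →
      r ∈ nYZ q.1 ×ˢ (univ : Finset G) → r ∉ nXZ p.1 ×ˢ (univ : Finset G) := by
  intro p q r hq hr hr'
  simp only [mem_product, mem_univ, and_true] at hq hr hr'
  exact t _ _ _ hq hr hr'

/-- Conversely a triangle of the base lifts to the blow-up (any copies will do), so for `G` non-empty the blow-up is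
triangle-free across `X, Y, Z` if and only if the base is. -/
theorem triangle_of_blowUp [Nonempty G] (nXY : X → Finset Y) (nYZ : Y → Finset Z) (nXZ : X → Finset Z)
    (t : ∀ (p : X × G) (q : Y × G) (r : Z × G), q ∈ nXY p.1 ×ˢ (univ : Finset G) →
      r ∈ nYZ q.1 ×ˢ (univ : Finset G) → r ∉ nXZ p.1 ×ˢ (univ : Finset G)) :
    ∀ x y z, y ∈ nXY x → z ∈ nYZ y → z ∉ nXZ x := by
  intro x y z hy hz hz'
  obtain ⟨i⟩ := ‹Nonempty G›
  refine t (x, i) (y, i) (z, i) ?_ ?_ ?_ <;> simp only [mem_product, mem_univ, and_true] <;> assumption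

end BlowUp

section FourCycles

variable {α β γ δ : Type*} {G : Type*} [Fintype α] [Fintype G] [DecidableEq γ] [DecidableEq G]

/-- **Blow-up multiplies every transversal-4-cycle sum by `g ^ 4`.** For one cyclic order, written as in the tree leg
of THEOREM L (`∑ a, ∑ b ∈ nAB a, ∑ e ∈ nAD a, #(nBC b ∩ nDC e)` for the order `(A B C D)`), the same sum for the
blown-up maps equals `g ^ 4` times the base sum: one factor `g` for the copies of `a`, of `b`, of `e`, and of the
common neighbour. The three cyclic orders are the three instances of this lemma, so ΣN(C₄) ↦ g⁴ ΣN(C₄). -/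
theorem fourCycleSum_blowUp (nAB : α → Finset β) (nAD : α → Finset δ) (nBC : β → Finset γ) (nDC : δ → Finset γ) :
    (∑ p : α × G, ∑ q ∈ nAB p.1 ×ˢ (univ : Finset G), ∑ s ∈ nAD p.1 ×ˢ (univ : Finset G),
        ((nBC q.1 ×ˢ (univ : Finset G)) ∩ (nDC s.1 ×ˢ (univ : Finset G))).card)
      = Fintype.card G ^ 4 * ∑ a, ∑ b ∈ nAB a, ∑ e ∈ nAD a, (nBC b ∩ nDC e).card := by
  -- the common-neighbour finsets of the blow-up are products with `univ`
  have hinter : ∀ (b : β) (e : δ), (nBC b ×ˢ (univ : Finset G)) ∩ (nDC e ×ˢ (univ : Finset G))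
      = (nBC b ∩ nDC e) ×ˢ (univ : Finset G) := by
    intro b e
    rw [product_inter_product, inter_self]
  simp_rw [hinter, card_product, card_univ]
  -- peel the three product sums
  simp_rw [sum_product, sum_const, card_univ, smul_eq_mul]
  rw [Fintype.sum_prod_type]
  simp_rw [sum_const, card_univ, smul_eq_mul]
  -- collect the four factors `g`
  simp_rw [mul_sum]
  refine sum_congr rfl fun a _ => ?_
  refine sum_congr rfl fun b _ => ?_
  refine sum_congr rfl fun e _ => ?_
  ring

/-- The K-secant value of N7F §3.9 (b) scales the same way: `(g t) (g d)² (7 (g d) − 2 (g t)) = g⁴ · t d² (7d − 2t)`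
(natural-number subtraction on both sides). -/
theorem ksecantValue_blowUp (g d t : ℕ) :
    (g * t) * (g * d) ^ 2 * (7 * (g * d) - 2 * (g * t)) = g ^ 4 * (t * d ^ 2 * (7 * d - 2 * t)) := by
  have h : 7 * (g * d) - 2 * (g * t) = g * (7 * d - 2 * t) := by
    rw [Nat.mul_sub]; ring_nf
  rw [h]
  ring

/-- Both sides of THEOREM L scale by `g ^ 4` under (d, t, ΣN) ↦ (g d, g t, g⁴ ΣN): `12 (g t) (g d)³ = g⁴ (12 t d³)` and
`2 (g⁴ N) + 3 (g t)² (g d)² = g⁴ (2 N + 3 t² d²)`. In particular equality in THEOREM L is preserved by blow-up. -/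
theorem thmL_bound_blowUp (g d t N : ℕ) :
    12 * (g * t) * (g * d) ^ 3 = g ^ 4 * (12 * t * d ^ 3) ∧
      2 * (g ^ 4 * N) + 3 * (g * t) ^ 2 * (g * d) ^ 2 = g ^ 4 * (2 * N + 3 * t ^ 2 * d ^ 2) := by
  constructor <;> ring

end FourCycles

section Cube

/-! ### The (1, 2) design: the cube `Q₃` with its four antipodal pairs as coordinates
All four coordinates are `Fin 2`; `nAB = nAC = nAD = fun a => {a}` and `nBC = nBD = nCD = fun b => {b + 1}` (with the
vertices of `Q₃ = {0,1}³` grouped into antipodal pairs `A = {000, 111}`, `B = {001, 110}`, `C = {010, 101}`,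
`D = {100, 011}` and level `0` = the representative with first bit `0`, cube adjacency is exactly these six matchings).
Every transpose is the map itself (`{·}` and `(· + 1)` are involutions on `Fin 2`). -/

/-- The cube design is 1-regular: every level has exactly one neighbour in each other coordinate. -/
theorem cube_degree : (∀ a : Fin 2, ({a} : Finset (Fin 2)).card = 1) ∧
    ∀ b : Fin 2, ({b + 1} : Finset (Fin 2)).card = 1 := by
  constructor <;> intro x <;> exact Finset.card_singleton _

/-- The two kinds of maps of the cube design are their own transposes. -/
theorem cube_transpose : (∀ a b : Fin 2, b ∈ ({a} : Finset (Fin 2)) ↔ a ∈ ({b} : Finset (Fin 2))) ∧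
    ∀ b c : Fin 2, c ∈ ({b + 1} : Finset (Fin 2)) ↔ b ∈ ({c + 1} : Finset (Fin 2)) := by
  constructor <;> decide

/-- The cube design is triangle-free: the four coordinate triples `ABC, ABD, ACD` (two singleton maps and one shift)
and `BCD` (three shifts) carry no triangle. -/
theorem cube_triangleFree :
    (∀ a b c : Fin 2, b ∈ ({a} : Finset (Fin 2)) → c ∈ ({b + 1} : Finset (Fin 2)) → c ∉ ({a} : Finset (Fin 2))) ∧
    (∀ b c e : Fin 2, c ∈ ({b + 1} : Finset (Fin 2)) → e ∈ ({c + 1} : Finset (Fin 2)) →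
      e ∉ ({b + 1} : Finset (Fin 2))) := by
  constructor <;> decide

/-- The cube has ΣN(C₄) = 6 transversal 4-cycles (its six faces), two in each cyclic order:
order `(A B C D)`: `∑ a, ∑ b ∈ {a}, ∑ e ∈ {a}, #({b+1} ∩ {e+1}) = 2`, and the orders `(A B D C)`, `(A C B D)` are the
same expression. -/
theorem cube_fourCycles :
    (∑ a : Fin 2, ∑ b ∈ ({a} : Finset (Fin 2)), ∑ e ∈ ({a} : Finset (Fin 2)),
        (({b + 1} : Finset (Fin 2)) ∩ ({e + 1} : Finset (Fin 2))).card) = 2 := by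
  decide

end Cube

section CubeBlowUp

variable {G : Type*} [Fintype G]

/-- **The g-fold blow-up of the cube is a flat (g, 2g) design**: `2 g` levels per coordinate, every level of degree
`g` in each of the three graphs it belongs to (both kinds of maps). -/
theorem cubeBlowUp_flat :
    Fintype.card (Fin 2 × G) = 2 * Fintype.card G ∧
    (∀ p : Fin 2 × G, (({p.1} : Finset (Fin 2)) ×ˢ (univ : Finset G)).card = Fintype.card G) ∧
    ∀ p : Fin 2 × G, (({p.1 + 1} : Finset (Fin 2)) ×ˢ (univ : Finset G)).card = Fintype.card G := by
  refine ⟨by rw [Fintype.card_prod, Fintype.card_fin], fun p => ?_, fun p => ?_⟩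
  · rw [card_blowUp (fun a : Fin 2 => ({a} : Finset (Fin 2))) 1 (fun a => card_singleton a) p, one_mul]
  · rw [card_blowUp (fun b : Fin 2 => ({b + 1} : Finset (Fin 2))) 1 (fun b => card_singleton _) p, one_mul]

/-- The blown-up cube maps are their own transposes (so the twelve neighbourhood maps of the design are these two
kinds of maps, each compatible with its transpose). -/
theorem cubeBlowUp_transpose :
    (∀ p q : Fin 2 × G, q ∈ ({p.1} : Finset (Fin 2)) ×ˢ (univ : Finset G) ↔
      p ∈ ({q.1} : Finset (Fin 2)) ×ˢ (univ : Finset G)) ∧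
    ∀ p q : Fin 2 × G, q ∈ ({p.1 + 1} : Finset (Fin 2)) ×ˢ (univ : Finset G) ↔
      p ∈ ({q.1 + 1} : Finset (Fin 2)) ×ˢ (univ : Finset G) :=
  ⟨mem_blowUp_iff _ _ cube_transpose.1, mem_blowUp_iff _ _ cube_transpose.2⟩

/-- **The blown-up cube is triangle-free** (both kinds of coordinate triples). -/
theorem cubeBlowUp_triangleFree :
    (∀ p q r : Fin 2 × G, q ∈ ({p.1} : Finset (Fin 2)) ×ˢ (univ : Finset G) →
      r ∈ ({q.1 + 1} : Finset (Fin 2)) ×ˢ (univ : Finset G) → r ∉ ({p.1} : Finset (Fin 2)) ×ˢ (univ : Finset G)) ∧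
    ∀ p q r : Fin 2 × G, q ∈ ({p.1 + 1} : Finset (Fin 2)) ×ˢ (univ : Finset G) →
      r ∈ ({q.1 + 1} : Finset (Fin 2)) ×ˢ (univ : Finset G) →
        r ∉ ({p.1 + 1} : Finset (Fin 2)) ×ˢ (univ : Finset G) :=
  ⟨triangleFree_blowUp _ _ _ cube_triangleFree.1, triangleFree_blowUp _ _ _ cube_triangleFree.2⟩

variable [DecidableEq G]

/-- **The blown-up cube has ΣN(C₄) = 6 g⁴**: each cyclic order contributes `2 g⁴` (the three orders are the same
expression, so ΣN(C₄) = 3 · 2 g⁴). -/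
theorem cubeBlowUp_fourCycles :
    (∑ p : Fin 2 × G, ∑ q ∈ ({p.1} : Finset (Fin 2)) ×ˢ (univ : Finset G),
        ∑ s ∈ ({p.1} : Finset (Fin 2)) ×ˢ (univ : Finset G),
          ((({q.1 + 1} : Finset (Fin 2)) ×ˢ (univ : Finset G)) ∩
            (({s.1 + 1} : Finset (Fin 2)) ×ˢ (univ : Finset G))).card) = 2 * Fintype.card G ^ 4 := by
  rw [fourCycleSum_blowUp (fun a : Fin 2 => ({a} : Finset (Fin 2))) (fun a : Fin 2 => ({a} : Finset (Fin 2)))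
    (fun b : Fin 2 => ({b + 1} : Finset (Fin 2))) (fun e : Fin 2 => ({e + 1} : Finset (Fin 2))),
    cube_fourCycles, mul_comm]

/-- **THEOREM L is sharp at every `t = 2d`.** With `d = g`, `t = 2 g` and ΣN(C₄) = N₁ + N₂ + N₃ of the blown-up
cube (the three cyclic orders `(A B C D)`, `(A B D C)`, `(A C B D)` of the tree leg are here three copies of the same
expression, since `nAB = nAC = nAD` and `nBC = nBD = nCD = nCB = nDB = nDC`), `12 t d³ = 2 ΣN(C₄) + 3 t² d²` —
EQUALITY in the inequality `twelve_mul_le` of `Summits/Ventures/HSemireg/FlatTriangleFreeFourCycles.lean`. -/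
theorem cubeBlowUp_thmL_eq :
    12 * (2 * Fintype.card G) * Fintype.card G ^ 3 =
      2 * ((∑ p : Fin 2 × G, ∑ q ∈ ({p.1} : Finset (Fin 2)) ×ˢ (univ : Finset G),
              ∑ s ∈ ({p.1} : Finset (Fin 2)) ×ˢ (univ : Finset G),
                ((({q.1 + 1} : Finset (Fin 2)) ×ˢ (univ : Finset G)) ∩
                  (({s.1 + 1} : Finset (Fin 2)) ×ˢ (univ : Finset G))).card)
          + (∑ p : Fin 2 × G, ∑ q ∈ ({p.1} : Finset (Fin 2)) ×ˢ (univ : Finset G),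
              ∑ r ∈ ({p.1} : Finset (Fin 2)) ×ˢ (univ : Finset G),
                ((({q.1 + 1} : Finset (Fin 2)) ×ˢ (univ : Finset G)) ∩
                  (({r.1 + 1} : Finset (Fin 2)) ×ˢ (univ : Finset G))).card)
          + (∑ p : Fin 2 × G, ∑ r ∈ ({p.1} : Finset (Fin 2)) ×ˢ (univ : Finset G),
              ∑ s ∈ ({p.1} : Finset (Fin 2)) ×ˢ (univ : Finset G),
                ((({r.1 + 1} : Finset (Fin 2)) ×ˢ (univ : Finset G)) ∩
                  (({s.1 + 1} : Finset (Fin 2)) ×ˢ (univ : Finset G))).card))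
        + 3 * (2 * Fintype.card G) ^ 2 * Fintype.card G ^ 2 := by
  rw [cubeBlowUp_fourCycles]
  ring

/-- The same equality as pure arithmetic: for `t = 2d` and `ΣN = 6 d⁴`, `12 t d³ = 2 ΣN + 3 t² d²` (both sides are
`24 d⁴`); and the K-secant value there is `t d² (7d − 2t) = 6 d⁴ = ΣN` as well (FLATTF §0: at `t = 2d` the class
equation holds — it is excluded only because `s² = 9d² > 8d² = 4m`, i.e. `K` would be real). -/
theorem thmL_eq_at_two_mul (d : ℕ) :
    12 * (2 * d) * d ^ 3 = 2 * (6 * d ^ 4) + 3 * (2 * d) ^ 2 * d ^ 2 ∧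
      (2 * d) * d ^ 2 * (7 * d - 2 * (2 * d)) = 6 * d ^ 4 ∧ ¬ (3 * d) ^ 2 < 4 * ((2 * d) * d) := by
  refine ⟨by ring, ?_, ?_⟩
  · have h : 7 * d - 2 * (2 * d) = 3 * d := by omega
    rw [h]; ring
  · intro h
    nlinarith [sq_nonneg d]

end CubeBlowUp

end Summit.Ventures.HSemireg.FlatDesignBlowUp
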